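import Literature.RingTheory.FormalGroups.UniversalFormalOModuleLawSeries
import Literature.RingTheory.FormalGroups.FormalOModuleLaw
import HarnessLib

/-!
# The universal formal `𝒪`-module law, II: `F_S` is a formal `𝒪`-module law over `𝒪[S₂,S₃,…]`
# ([Hazewinkel 1978] §21.4 (21.4.6)–(21.4.8); [Drinfeld 1974] §1)

Topic `Literature/RingTheory/FormalGroups`; namespace `Literature.RingTheory.FormalGroups.UnivOModule`.  DEFINITIONS
(`lawInt`, `actInt`, `univLaw`) + fully proved theorems; no named fact, no instance, no notation, no `sorry`.  Sequel of
`UniversalFormalOModuleLawSeries.lean` (the logarithm `f_S`, `F_S = f_S⁻¹(f_S X + f_S Y)`, `[a]_S = f_S⁻¹(a f_S)` over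
`K = 𝒪[1/π][S]` and their integrality).  Cell `hodgecm-mathlib`, P6 «MOD programme» ROW 4B, letter L4B.3c𝒪.

Here (`hA : IsLTRing π q`, `hq : 2 ≤ q`):
* §1 the identities over `K`, all by conjugation with `f_S` ("`f_S(F_S(u,v)) = f_S(u) + f_S(v)`",
  "`f_S([c]_S(u)) = c·f_S(u)`", and `f_S`-cancellation `eq_of_logSeries_subst_eq`): associativity, commutativity, unit
  coefficients of `F_S`; `[c]_S` is an endomorphism of `F_S`, `[a+b] = F_S([a],[b])`, `[ab] = [a]∘[b]`, `[1] = X`, `[0] = 0`,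
  `[c] ≡ cX (mod deg 2)`;
* §2 descent to `𝒪[S] = MvPolynomial ℕ 𝒪` along the injection `incl : 𝒪[S] → K` (`lawInt`, `actInt`,
  `map_incl_lawInt`, `map_incl_actInt`);
* §3 **`univLaw hA hq : FormalOModuleLaw 𝒪 (MvPolynomial ℕ 𝒪)`** — Hazewinkel's universal formal `𝒪`-module law
  `(F_S, [·]_S)` as a ★ `FormalOModuleLaw` ([Hazewinkel1978] (21.4.8); universality itself — [Hazewinkel1978] Thm. 21.4.?
  ∕ [Drinfeld1974] Prop. 1.4 — is the business of the lifting file).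

## References
* M. Hazewinkel, *Formal Groups and Applications* (1978), §21.4 (21.4.5)–(21.4.8), §2.2. [Hazewinkel1978]
* V. G. Drinfeld, *Elliptic modules*, Math. USSR-Sb. 23 (1974), §1. [Drinfeld1974]
-/

noncomputable section

open scoped Classical

namespace Literature.RingTheory.FormalGroups

namespace UnivOModule

open MvPowerSeries Literature.NumberTheory.GaloisRepresentations.LubinTate

universe u v

variable {𝒪 : Type u} [CommRing 𝒪] {π : 𝒪} {q : ℕ}

/-! ## §1 Identities over `K` -/

section OverK

variable (π q)

/-- `f_S⁻¹(f_S(u)) = u`. [cite: Hazewinkel1978, §21.4 (21.4.6)] -/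
theorem expSeries_subst_logSeries_subst (hq : 2 ≤ q) {υ : Type v} {u : MvPowerSeries υ (KS π)}
    (hu : constantCoeff u = 0) :
    PowerSeries.subst (PowerSeries.subst u (logSeries π q)) (expSeries π q hq) = u := by
  rw [← PowerSeries.subst_comp_subst_apply (PowerSeries.HasSubst.of_constantCoeff_zero' constantCoeff_logSeries)
    (PowerSeries.HasSubst.of_constantCoeff_zero hu), expSeries_subst_logSeries hq,
    PowerSeries.subst_X (PowerSeries.HasSubst.of_constantCoeff_zero hu)]

/-- **`f_S`-cancellation**: series without constant term with the same `f_S`-image are equal.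
[cite: Hazewinkel1978, §21.4 (21.4.6)] -/
theorem eq_of_logSeries_subst_eq (hq : 2 ≤ q) {υ : Type v} {u v : MvPowerSeries υ (KS π)}
    (hu : constantCoeff u = 0) (hv : constantCoeff v = 0)
    (h : PowerSeries.subst u (logSeries π q) = PowerSeries.subst v (logSeries π q)) : u = v := by
  rw [← expSeries_subst_logSeries_subst π q hq hu, h, expSeries_subst_logSeries_subst π q hq hv]

/-- `F_S(u,v)` has no constant term. [cite: Hazewinkel1978, §21.4 (21.4.6)] -/
theorem constantCoeff_lawK_subst (hq : 2 ≤ q) {υ : Type v} {u v : MvPowerSeries υ (KS π)}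
    (hu : constantCoeff u = 0) (hv : constantCoeff v = 0) :
    constantCoeff ((lawK π q hq).subst ![u, v]) = 0 :=
  MvPowerSeries.constantCoeff_subst_eq_zero (hasSubst_pair (PowerSeries.HasSubst.of_constantCoeff_zero hu)
    (PowerSeries.HasSubst.of_constantCoeff_zero hv)) (fun i => by fin_cases i <;> simpa) (constantCoeff_lawK hq)

/-- **`f_S(F_S(u,v)) = f_S(u) + f_S(v)`.** [cite: Hazewinkel1978, §21.4 (21.4.6)] -/
theorem logSeries_subst_lawK_subst (hq : 2 ≤ q) {υ : Type v} {u v : MvPowerSeries υ (KS π)}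
    (hu : constantCoeff u = 0) (hv : constantCoeff v = 0) :
    PowerSeries.subst ((lawK π q hq).subst ![u, v]) (logSeries π q) =
      PowerSeries.subst u (logSeries π q) + PowerSeries.subst v (logSeries π q) := by
  have hb : HasSubst ![u, v] :=
    hasSubst_pair (PowerSeries.HasSubst.of_constantCoeff_zero hu) (PowerSeries.HasSubst.of_constantCoeff_zero hv)
  have hW : PowerSeries.HasSubst (PowerSeries.subst (MvPowerSeries.X 0 : MvPowerSeries (Fin 2) (KS π)) (logSeries π q) +
      PowerSeries.subst (MvPowerSeries.X 1 : MvPowerSeries (Fin 2) (KS π)) (logSeries π q)) := by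
    apply PowerSeries.HasSubst.of_constantCoeff_zero
    rw [map_add, PowerSeries.constantCoeff_subst_eq_zero (MvPowerSeries.constantCoeff_X 0) _ constantCoeff_logSeries,
      PowerSeries.constantCoeff_subst_eq_zero (MvPowerSeries.constantCoeff_X 1) _ constantCoeff_logSeries, add_zero]
  rw [lawK, subst_powerSeries_subst hW hb, subst_add hb, subst_powerSeries_subst (PowerSeries.HasSubst.X 0) hb,
    subst_powerSeries_subst (PowerSeries.HasSubst.X 1) hb, subst_X hb, subst_X hb]
  simp only [Matrix.cons_val_zero, Matrix.cons_val_one]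
  apply logSeries_subst_expSeries_subst hq
  rw [map_add, PowerSeries.constantCoeff_subst_eq_zero hu _ constantCoeff_logSeries,
    PowerSeries.constantCoeff_subst_eq_zero hv _ constantCoeff_logSeries, add_zero]

/-- `[c]_S(u)` has no constant term. [cite: Hazewinkel1978, §21.4 (21.4.7)] -/
theorem constantCoeff_actK_subst (hq : 2 ≤ q) (c : KS π) {υ : Type v} {u : MvPowerSeries υ (KS π)}
    (hu : constantCoeff u = 0) : constantCoeff (PowerSeries.subst u (actK π q hq c)) = 0 :=
  PowerSeries.constantCoeff_subst_eq_zero hu _ (constantCoeff_actK hq c)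

/-- **`f_S([c]_S(u)) = c · f_S(u)`.** [cite: Hazewinkel1978, §21.4 (21.4.7)] -/
theorem logSeries_subst_actK_subst (hq : 2 ≤ q) (c : KS π) {υ : Type v} {u : MvPowerSeries υ (KS π)}
    (hu : constantCoeff u = 0) :
    PowerSeries.subst (PowerSeries.subst u (actK π q hq c)) (logSeries π q) = c • PowerSeries.subst u (logSeries π q) := by
  rw [← PowerSeries.subst_comp_subst_apply (PowerSeries.HasSubst.of_constantCoeff_zero' (constantCoeff_actK hq c))
    (PowerSeries.HasSubst.of_constantCoeff_zero hu), logSeries_subst_actK hq c,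
    PowerSeries.subst_smul (PowerSeries.HasSubst.of_constantCoeff_zero hu)]

/-- **Associativity of `F_S`** (over `K`): `f_S` of both sides is `f_S(Y₀) + f_S(Y₁) + f_S(Y₂)`.
[cite: Hazewinkel1978, §21.4 (21.4.8)] -/
theorem lawK_assoc (hq : 2 ≤ q) :
    (lawK π q hq).subst ![(lawK π q hq).subst ![(MvPowerSeries.X 0 : MvPowerSeries (Fin 3) (KS π)), MvPowerSeries.X 1],
        MvPowerSeries.X 2] =
      (lawK π q hq).subst ![MvPowerSeries.X 0,
        (lawK π q hq).subst ![(MvPowerSeries.X 1 : MvPowerSeries (Fin 3) (KS π)), MvPowerSeries.X 2]] := by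
  have h01 := constantCoeff_lawK_subst π q hq (MvPowerSeries.constantCoeff_X (0 : Fin 3)) (MvPowerSeries.constantCoeff_X 1)
  have h12 := constantCoeff_lawK_subst π q hq (MvPowerSeries.constantCoeff_X (1 : Fin 3)) (MvPowerSeries.constantCoeff_X 2)
  apply eq_of_logSeries_subst_eq π q hq (constantCoeff_lawK_subst π q hq h01 (MvPowerSeries.constantCoeff_X 2))
    (constantCoeff_lawK_subst π q hq (MvPowerSeries.constantCoeff_X 0) h12)
  rw [logSeries_subst_lawK_subst π q hq h01 (MvPowerSeries.constantCoeff_X 2), logSeries_subst_lawK_subst π q hq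
    (MvPowerSeries.constantCoeff_X 0) (MvPowerSeries.constantCoeff_X 1), logSeries_subst_lawK_subst π q hq
    (MvPowerSeries.constantCoeff_X 0) h12, logSeries_subst_lawK_subst π q hq (MvPowerSeries.constantCoeff_X 1)
    (MvPowerSeries.constantCoeff_X 2), add_assoc]

/-- **Commutativity of `F_S`** (over `K`). [cite: Hazewinkel1978, §21.4 (21.4.8)] -/
theorem lawK_comm (hq : 2 ≤ q) :
    (lawK π q hq).subst ![MvPowerSeries.X (1 : Fin 2), MvPowerSeries.X 0] = lawK π q hq := by
  apply eq_of_logSeries_subst_eq π q hq (constantCoeff_lawK_subst π q hq (MvPowerSeries.constantCoeff_X (1 : Fin 2))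
    (MvPowerSeries.constantCoeff_X 0)) (constantCoeff_lawK hq)
  rw [logSeries_subst_lawK_subst π q hq (MvPowerSeries.constantCoeff_X 1) (MvPowerSeries.constantCoeff_X 0),
    logSeries_subst_lawK hq, add_comm]

/-- The linear coefficients of `F_S`: `F_S ≡ X + Y (mod deg 2)`. [cite: Hazewinkel1978, §21.4 (21.4.8)] -/
theorem coeff_single_lawK (hq : 2 ≤ q) (j : Fin 2) : coeff (Finsupp.single j 1) (lawK π q hq) = 1 := by
  -- compare the coefficient of `X_j` in `f_S(F_S) = f_S(X₀) + f_S(X₁)`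
  have h := congrArg (coeff (Finsupp.single j 1)) (logSeries_subst_lawK (π := π) hq)
  rw [coeff_psubst_eq_sum (constantCoeff_lawK hq), Finsupp.degree_single, Finset.sum_range_succ,
    Finset.sum_range_succ, Finset.sum_range_zero, zero_add, pow_zero, pow_one, coeff_logSeries, coeff_logSeries,
    logCoeff_zero, zero_mul, zero_add, ← coeff_logSeries, coeff_one_logSeries hq, one_mul, map_add,
    PowerSeries.coeff_subst_single, PowerSeries.coeff_subst_single] at h
  rw [h]
  fin_cases j
  · simp [coeff_one_logSeries hq]
  · simp [coeff_one_logSeries hq]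

/-- **`[c]_S` is an endomorphism of `F_S`** (over `K`): `[c](F_S(X,Y)) = F_S([c]X, [c]Y)`.
[cite: Hazewinkel1978, §21.4 (21.4.8)] -/
theorem actK_subst_lawK (hq : 2 ≤ q) (c : KS π) :
    PowerSeries.subst (lawK π q hq) (actK π q hq c) =
      (lawK π q hq).subst ![PowerSeries.subst (MvPowerSeries.X (0 : Fin 2)) (actK π q hq c),
        PowerSeries.subst (MvPowerSeries.X (1 : Fin 2)) (actK π q hq c)] := by
  have h0 := constantCoeff_actK_subst π q hq c (MvPowerSeries.constantCoeff_X (0 : Fin 2))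
  have h1 := constantCoeff_actK_subst π q hq c (MvPowerSeries.constantCoeff_X (1 : Fin 2))
  apply eq_of_logSeries_subst_eq π q hq (constantCoeff_actK_subst π q hq c (constantCoeff_lawK hq))
    (constantCoeff_lawK_subst π q hq h0 h1)
  rw [logSeries_subst_actK_subst π q hq c (constantCoeff_lawK hq), logSeries_subst_lawK hq,
    logSeries_subst_lawK_subst π q hq h0 h1, logSeries_subst_actK_subst π q hq c (MvPowerSeries.constantCoeff_X 0),
    logSeries_subst_actK_subst π q hq c (MvPowerSeries.constantCoeff_X 1), smul_add]

/-- `[a + b]_S = F_S([a]_S, [b]_S)` (over `K`). [cite: Hazewinkel1978, §21.4 (21.4.8)] -/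
theorem actK_add (hq : 2 ≤ q) (a b : KS π) :
    actK π q hq (a + b) = (lawK π q hq).subst ![actK π q hq a, actK π q hq b] := by
  apply eq_of_logSeries_subst_eq π q hq (constantCoeff_actK hq _)
    (constantCoeff_lawK_subst π q hq (constantCoeff_actK hq a) (constantCoeff_actK hq b))
  rw [logSeries_subst_actK hq, logSeries_subst_lawK_subst π q hq (constantCoeff_actK hq a) (constantCoeff_actK hq b),
    logSeries_subst_actK hq, logSeries_subst_actK hq, add_smul]

/-- `[a b]_S = [a]_S ∘ [b]_S` (over `K`). [cite: Hazewinkel1978, §21.4 (21.4.8)] -/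
theorem actK_mul (hq : 2 ≤ q) (a b : KS π) :
    actK π q hq (a * b) = PowerSeries.subst (actK π q hq b) (actK π q hq a) := by
  apply eq_of_logSeries_subst_eq π q hq (constantCoeff_actK hq _)
    (constantCoeff_actK_subst π q hq a (constantCoeff_actK hq b))
  rw [logSeries_subst_actK hq, logSeries_subst_actK_subst π q hq a (constantCoeff_actK hq b), logSeries_subst_actK hq,
    smul_smul]

/-- `[1]_S = X` (over `K`). [cite: Hazewinkel1978, §21.4 (21.4.8)] -/
theorem actK_one (hq : 2 ≤ q) : actK π q hq 1 = PowerSeries.X := by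
  rw [actK, one_smul, expSeries_subst_logSeries hq]

/-- `[0]_S = 0` (over `K`). [cite: Hazewinkel1978, §21.4 (21.4.8)] -/
theorem actK_zero (hq : 2 ≤ q) : actK π q hq 0 = 0 := by
  rw [actK, zero_smul, PowerSeries.subst_zero_of_constantCoeff_zero (constantCoeff_expSeries hq)]

/-- `[c]_S ≡ c·X (mod deg 2)` (over `K`). [cite: Hazewinkel1978, §21.4 (21.4.7)] -/
theorem coeff_one_actK (hq : 2 ≤ q) (c : KS π) : PowerSeries.coeff 1 (actK π q hq c) = c := by
  -- compare the coefficient of `X` in `f_S([c]) = c f_S`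
  have h := congrArg (PowerSeries.coeff 1) (logSeries_subst_actK (π := π) hq c)
  rw [PowerSeries.coeff_smul, coeff_one_logSeries hq, smul_eq_mul, mul_one,
    PowerSeries.coeff_def (s := Finsupp.single () 1) (Finsupp.single_eq_same),
    coeff_psubst_eq_sum (constantCoeff_actK hq c), Finsupp.degree_single, Finset.sum_range_succ,
    Finset.sum_range_succ, Finset.sum_range_zero, zero_add, pow_zero, pow_one, coeff_logSeries, coeff_logSeries,
    logCoeff_zero, zero_mul, zero_add, ← coeff_logSeries, coeff_one_logSeries hq, one_mul,
    ← PowerSeries.coeff_def (s := Finsupp.single () 1) (Finsupp.single_eq_same)] at h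
  exact h

end OverK

/-! ## §2 Descent to `𝒪[S]` -/

section Descent

/-- `map` along an injective ring map is injective on multivariate power series. [folklore] -/
private theorem map_injective_of_injective {R S : Type*} [CommRing R] [CommRing S] {σ : Type*} {f : R →+* S}
    (hf : Function.Injective f) : Function.Injective (MvPowerSeries.map (σ := σ) f) := by
  intro x y h
  ext d
  apply hf
  rw [← coeff_map, ← coeff_map, h]

variable (π q)

/-- **`F_S` as a series over `𝒪[S]`** (its coefficients lie in `𝒪[S]`, `coeff_lawK_mem`). [cite: Hazewinkel1978, §21.4 (21.4.6)] -/
def lawInt (hA : IsLTRing π q) (hq : 2 ≤ q) : MvPowerSeries (Fin 2) (MvPolynomial ℕ 𝒪) := fun d =>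
  (mem_intSubring_iff.mp (coeff_lawK_mem hA hq d)).choose

/-- **`[a]_S` as a series over `𝒪[S]`** (`coeff_actK_mem`). [cite: Hazewinkel1978, §21.4 (21.4.7)] -/
def actInt (hA : IsLTRing π q) (hq : 2 ≤ q) (a : 𝒪) : PowerSeries (MvPolynomial ℕ 𝒪) := PowerSeries.mk fun n =>
  (mem_intSubring_iff.mp (coeff_actK_mem hA hq a n)).choose

variable {π q}

/-- `incl_* lawInt = F_S`. [cite: Hazewinkel1978, §21.4 (21.4.6)] -/
theorem map_incl_lawInt (hA : IsLTRing π q) (hq : 2 ≤ q) : map (incl π) (lawInt π q hA hq) = lawK π q hq := by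
  refine MvPowerSeries.ext fun d => ?_
  rw [coeff_map]
  exact (mem_intSubring_iff.mp (coeff_lawK_mem hA hq d)).choose_spec

/-- `incl_* (actInt a) = [a]_S`. [cite: Hazewinkel1978, §21.4 (21.4.7)] -/
theorem map_incl_actInt (hA : IsLTRing π q) (hq : 2 ≤ q) (a : 𝒪) :
    PowerSeries.map (incl π) (actInt π q hA hq a) = actK π q hq (MvPolynomial.C (algebraMap 𝒪 (Localization.Away π) a)) := by
  refine PowerSeries.ext fun n => ?_
  rw [PowerSeries.coeff_map, actInt, PowerSeries.coeff_mk]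
  exact (mem_intSubring_iff.mp (coeff_actK_mem hA hq a n)).choose_spec

/-- `map` along a ring map, entrywise on a `2`-vector (plumbing). [folklore] -/
private theorem map_vec2 {R S : Type*} [CommRing R] [CommRing S] (f : R →+* S) {τ : Type*} (x y : MvPowerSeries τ R) :
    (fun i => MvPowerSeries.map f ((![x, y] : Fin 2 → MvPowerSeries τ R) i)) = ![MvPowerSeries.map f x, MvPowerSeries.map f y] := by
  funext i; fin_cases i <;> simp

/-- `incl_*` of a substitution of a pair into `lawInt`. [cite: Hazewinkel1978, §21.4 (21.4.6)] -/
theorem map_incl_lawInt_subst (hA : IsLTRing π q) (hq : 2 ≤ q) {υ : Type v} {u v : MvPowerSeries υ (MvPolynomial ℕ 𝒪)}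
    (hu : constantCoeff u = 0) (hv : constantCoeff v = 0) :
    map (incl π) ((lawInt π q hA hq).subst ![u, v]) = (lawK π q hq).subst ![map (incl π) u, map (incl π) v] := by
  rw [MvPowerSeries.map_subst (hasSubst_pair (PowerSeries.HasSubst.of_constantCoeff_zero hu)
    (PowerSeries.HasSubst.of_constantCoeff_zero hv)), map_vec2, map_incl_lawInt]

/-- `incl(constant coefficient)`. [folklore] -/
private theorem constantCoeff_map_incl {υ : Type v} (u : MvPowerSeries υ (MvPolynomial ℕ 𝒪)) :
    constantCoeff (map (incl π) u) = incl π (constantCoeff u) := constantCoeff_map _ _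

end Descent

/-! ## §3 The universal formal `𝒪`-module law over `𝒪[S]` -/

section Law

variable (π q)

/-- **Hazewinkel's universal formal `𝒪`-module law `(F_S, [·]_S)` over `𝒪[S₂, S₃, …] = MvPolynomial ℕ 𝒪`** (for `(𝒪, π, q)` with
★ `IsLTRing π q`, `q ≥ 2`), as a ★ `FormalOModuleLaw`: `F_S(X,Y) = f_S⁻¹(f_S(X) + f_S(Y))`, `[a]_S(X) = f_S⁻¹(a·f_S(X))`,
both with coefficients in `𝒪[S]` by the functional equation lemma; all the axioms hold over `K = 𝒪[1/π][S]` by conjugation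
with `f_S` and descend along the injection `𝒪[S] → K`. [cite: Hazewinkel1978, §21.4 (21.4.8)] [cite: Drinfeld1974, §1 Prop. 1.4] -/
def univLaw (hA : IsLTRing π q) (hq : 2 ≤ q) : FormalOModuleLaw 𝒪 (MvPolynomial ℕ 𝒪) where
  toFormalGroup :=
    { toPowerSeries := lawInt π q hA hq
      zero_constantCoeff := by
        apply incl_injective hA
        rw [← constantCoeff_map, map_incl_lawInt, constantCoeff_lawK hq, map_zero]
      lin_coeff_X := by
        apply incl_injective hA
        rw [← coeff_map, map_incl_lawInt, coeff_single_lawK π q hq 0, map_one]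
      lin_coeff_Y := by
        apply incl_injective hA
        rw [← coeff_map, map_incl_lawInt, coeff_single_lawK π q hq 1, map_one]
      assoc := by
        apply map_injective_of_injective (incl_injective hA)
        have h01 : constantCoeff ((lawInt π q hA hq).subst ![(MvPowerSeries.X 0 : MvPowerSeries (Fin 3) (MvPolynomial ℕ 𝒪)), MvPowerSeries.X 1]) = 0 := by
          apply incl_injective hA
          rw [← constantCoeff_map, map_incl_lawInt_subst hA hq (MvPowerSeries.constantCoeff_X 0)
            (MvPowerSeries.constantCoeff_X 1), map_X, map_X, map_zero]
          exact constantCoeff_lawK_subst π q hq (MvPowerSeries.constantCoeff_X 0) (MvPowerSeries.constantCoeff_X 1)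
        have h12 : constantCoeff ((lawInt π q hA hq).subst ![(MvPowerSeries.X 1 : MvPowerSeries (Fin 3) (MvPolynomial ℕ 𝒪)), MvPowerSeries.X 2]) = 0 := by
          apply incl_injective hA
          rw [← constantCoeff_map, map_incl_lawInt_subst hA hq (MvPowerSeries.constantCoeff_X 1)
            (MvPowerSeries.constantCoeff_X 2), map_X, map_X, map_zero]
          exact constantCoeff_lawK_subst π q hq (MvPowerSeries.constantCoeff_X 1) (MvPowerSeries.constantCoeff_X 2)
        rw [map_incl_lawInt_subst hA hq h01 (MvPowerSeries.constantCoeff_X 2),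
          map_incl_lawInt_subst hA hq (MvPowerSeries.constantCoeff_X 0) (MvPowerSeries.constantCoeff_X 1),
          map_incl_lawInt_subst hA hq (MvPowerSeries.constantCoeff_X 0) h12,
          map_incl_lawInt_subst hA hq (MvPowerSeries.constantCoeff_X 1) (MvPowerSeries.constantCoeff_X 2),
          map_X, map_X, map_X, lawK_assoc π q hq] }
  isComm :=
    { comm := by
        change lawInt π q hA hq = (lawInt π q hA hq).subst ![(MvPowerSeries.X 1 : MvPowerSeries (Fin 2) (MvPolynomial ℕ 𝒪)), MvPowerSeries.X 0]
        apply map_injective_of_injective (incl_injective hA)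
        rw [map_incl_lawInt_subst hA hq (MvPowerSeries.constantCoeff_X 1) (MvPowerSeries.constantCoeff_X 0), map_X, map_X,
          map_incl_lawInt, lawK_comm π q hq] }
  act a :=
    { toPowerSeries := actInt π q hA hq a
      constantCoeff_eq_zero := by
        apply incl_injective hA
        rw [← PowerSeries.coeff_zero_eq_constantCoeff_apply, ← PowerSeries.coeff_map, map_incl_actInt,
          PowerSeries.coeff_zero_eq_constantCoeff_apply, constantCoeff_actK hq, map_zero]
      map_add := by
        have ha0 : PowerSeries.constantCoeff (actInt π q hA hq a) = 0 := by
          apply incl_injective hA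
          rw [← PowerSeries.coeff_zero_eq_constantCoeff_apply, ← PowerSeries.coeff_map, map_incl_actInt,
            PowerSeries.coeff_zero_eq_constantCoeff_apply, constantCoeff_actK hq, map_zero]
        have hF0 : constantCoeff (lawInt π q hA hq) = 0 := by
          apply incl_injective hA
          rw [← constantCoeff_map, map_incl_lawInt, constantCoeff_lawK hq, map_zero]
        have h0 : constantCoeff (PowerSeries.subst (MvPowerSeries.X 0 : MvPowerSeries (Fin 2) (MvPolynomial ℕ 𝒪))
            (actInt π q hA hq a)) = 0 := PowerSeries.constantCoeff_subst_eq_zero (MvPowerSeries.constantCoeff_X 0) _ ha0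
        have h1 : constantCoeff (PowerSeries.subst (MvPowerSeries.X 1 : MvPowerSeries (Fin 2) (MvPolynomial ℕ 𝒪))
            (actInt π q hA hq a)) = 0 := PowerSeries.constantCoeff_subst_eq_zero (MvPowerSeries.constantCoeff_X 1) _ ha0
        apply map_injective_of_injective (incl_injective hA)
        change map (incl π) (PowerSeries.subst (lawInt π q hA hq) (actInt π q hA hq a)) =
          map (incl π) ((lawInt π q hA hq).subst
            ![PowerSeries.subst (MvPowerSeries.X 0 : MvPowerSeries (Fin 2) (MvPolynomial ℕ 𝒪)) (actInt π q hA hq a),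
              PowerSeries.subst (MvPowerSeries.X 1 : MvPowerSeries (Fin 2) (MvPolynomial ℕ 𝒪)) (actInt π q hA hq a)])
        rw [PowerSeries.map_subst (PowerSeries.HasSubst.of_constantCoeff_zero hF0), map_incl_actInt, map_incl_lawInt,
          map_incl_lawInt_subst hA hq h0 h1, PowerSeries.map_subst (PowerSeries.HasSubst.X 0),
          PowerSeries.map_subst (PowerSeries.HasSubst.X 1), map_X, map_X, map_incl_actInt, actK_subst_lawK π q hq] }
  coeff_one_act a := by
    apply incl_injective hA
    change incl π (PowerSeries.coeff 1 (actInt π q hA hq a)) = _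
    rw [← PowerSeries.coeff_map, map_incl_actInt, coeff_one_actK π q hq, incl, MvPolynomial.algebraMap_eq,
      MvPolynomial.map_C]
  act_zero := by
    apply PowerSeries.map_injective (incl π) (incl_injective hA)
    change PowerSeries.map (incl π) (actInt π q hA hq 0) = _
    rw [map_incl_actInt, map_zero, map_zero, map_zero, actK_zero π q hq]
  act_one := by
    apply PowerSeries.map_injective (incl π) (incl_injective hA)
    change PowerSeries.map (incl π) (actInt π q hA hq 1) = _
    rw [map_incl_actInt, map_one, map_one, PowerSeries.map_X, actK_one π q hq]
  act_add a b := by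
    have ha0 : ∀ a, PowerSeries.constantCoeff (actInt π q hA hq a) = 0 := fun a => by
      apply incl_injective hA
      rw [← PowerSeries.coeff_zero_eq_constantCoeff_apply, ← PowerSeries.coeff_map, map_incl_actInt,
        PowerSeries.coeff_zero_eq_constantCoeff_apply, constantCoeff_actK hq, map_zero]
    apply map_injective_of_injective (incl_injective hA)
    change map (incl π) (actInt π q hA hq (a + b)) = map (incl π) ((lawInt π q hA hq).subst ![actInt π q hA hq a,
      actInt π q hA hq b])
    rw [map_incl_lawInt_subst hA hq (ha0 a) (ha0 b)]
    change PowerSeries.map (incl π) (actInt π q hA hq (a + b)) = (lawK π q hq).subst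
      ![PowerSeries.map (incl π) (actInt π q hA hq a), PowerSeries.map (incl π) (actInt π q hA hq b)]
    rw [map_incl_actInt, map_incl_actInt, map_incl_actInt, map_add, map_add, actK_add π q hq]
  act_mul a b := by
    have hb0 : PowerSeries.constantCoeff (actInt π q hA hq b) = 0 := by
      apply incl_injective hA
      rw [← PowerSeries.coeff_zero_eq_constantCoeff_apply, ← PowerSeries.coeff_map, map_incl_actInt,
        PowerSeries.coeff_zero_eq_constantCoeff_apply, constantCoeff_actK hq, map_zero]
    apply PowerSeries.map_injective (incl π) (incl_injective hA)
    change PowerSeries.map (incl π) (actInt π q hA hq (a * b)) =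
      PowerSeries.map (incl π) (PowerSeries.subst (actInt π q hA hq b) (actInt π q hA hq a))
    rw [map_incl_actInt, map_mul, map_mul, actK_mul π q hq]
    change _ = map (incl π) (PowerSeries.subst (actInt π q hA hq b) (actInt π q hA hq a))
    rw [PowerSeries.map_subst (PowerSeries.HasSubst.of_constantCoeff_zero' hb0)]
    change _ = PowerSeries.subst (PowerSeries.map (incl π) (actInt π q hA hq b)) (PowerSeries.map (incl π) (actInt π q hA hq a))
    rw [map_incl_actInt, map_incl_actInt]

variable {π q}

/-- The law of `univLaw` is `lawInt` (i.e. `F_S` over `𝒪[S]`). [cite: Hazewinkel1978, §21.4 (21.4.8)] -/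
@[simp] theorem univLaw_toPowerSeries (hA : IsLTRing π q) (hq : 2 ≤ q) :
    (univLaw π q hA hq).toFormalGroup.toPowerSeries = lawInt π q hA hq := rfl

/-- The action of `univLaw` is `actInt` (i.e. `[a]_S` over `𝒪[S]`). [cite: Hazewinkel1978, §21.4 (21.4.8)] -/
@[simp] theorem univLaw_act (hA : IsLTRing π q) (hq : 2 ≤ q) (a : 𝒪) :
    ((univLaw π q hA hq).act a).toPowerSeries = actInt π q hA hq a := rfl

/-- `incl_* F_S^{int} = F_S`. [cite: Hazewinkel1978, §21.4 (21.4.8)] -/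
theorem map_incl_univLaw (hA : IsLTRing π q) (hq : 2 ≤ q) :
    ((univLaw π q hA hq).toFormalGroup.map (incl π)).toPowerSeries = lawK π q hq := map_incl_lawInt hA hq

end Law

end UnivOModule

end Literature.RingTheory.FormalGroups
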